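import Summits.HodgeConjecture.HodgeCM.PerL34.GenuineSchrodingerRigid_1

/-! PORT of `HodgeCM/PerL34/GenuineSchrodingerRigid.lean` (HodgeCMPerL run 82) — part 2: continuation of `Summits.HodgeConjecture.HodgeCM.PerL34.GenuineSchrodingerRigid_1` (split at a top-level declaration boundary by port_pkg.py; scope re-opened below; declarations unchanged). -/

-- port_pkg: scope re-opened for this part (file-level context, then the namespace/section stack open at the cut)
set_option autoImplicit false
noncomputable section
open MeasureTheory MeasureTheory.Measure Set Metric Function Complex Topology Filter
open scoped RestrictedProduct InnerProductSpace NNReal ENNReal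
namespace HodgeCM.PerL34.PureTensor.SchrodingerModel
open HodgeCM.PerL34.LocalFactors HodgeCM.PerL34.LocalFactors.DilationModel
open HodgeCM.PerL34.LocalFactors.SchrodingerLevi HodgeCM.PerL34.LocalFactors.SchrodingerIrreducible
open HodgeCM.PerL34.IdelePlaces HodgeCM.PerL34.IdelicTorusModel HodgeCM.PerL34.IdelicTorusModel.Genuine
open NumberField IsDedekindDomain
attribute [local instance] LocalFactors.DilationModel.Adic.nontriviallyNormedField
  LocalFactors.DilationModel.Adic.properSpace
variable {L : Type} [Field L] [NumberField L] [IsCMField L]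
local notation3 "L⁺" => maximalRealSubfield L
section Characters
variable (ψ : ∀ i : SplitIdx L, AddChar ((basePlaceOf L i.1).adicCompletion (maximalRealSubfield L)) Circle)
  (hψc : ∀ i, Continuous (ψ i))
/-- **Adelic Stone–von Neumann on `L²(X)`.**  For any family `ψ = (ψ_v)_{v split}` of non-trivial
continuous unitary additive characters of the `L⁺_v` and any set `𝓜` of modulation characters of
`X` containing the adelic coordinate Heisenberg characters `u ↦ ψ_v(s·u_{v,j})`, the Schrödinger
system `{τ_y : y ∈ X} ∪ {M_χ : χ ∈ 𝓜}` on `L²(X, dx)` has SCALAR COMMUTANT: a bounded operator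
commuting with all adelic translations and all these modulations is a scalar.  (Instance of the
RUN-28 theorem `hasScalarCommutant_schrodingerSystem` for the second countable locally compact
abelian group `X`, the compact-open basis `levelBall L` of §2 and the countable separating family
of §3.) -/
theorem hasScalarCommutant_schrodingerSystem_space (hψ : ∀ i, ∃ t, ψ i t ≠ 1)
    (𝓜 : Set C(Space L, Circle))
    (h𝓜 : ∀ (i : SplitIdx L) (j : Fin 3) (s : (basePlaceOf L i.1).adicCompletion (maximalRealSubfield L)),
      adelicCoordChar ψ hψc i j s ∈ 𝓜) :
    HasScalarCommutant (Lp ℂ 2 (μ L)) (schrodingerSystem (μ L) 𝓜) := by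
  classical
  set 𝓜₀ : Set C(Space L, Circle) := Set.range fun p : (SplitIdx L × Fin 3) × ℕ =>
    adelicCoordChar ψ hψc p.1.1 p.1.2
      (TopologicalSpace.denseSeq ((basePlaceOf L p.1.1.1).adicCompletion (maximalRealSubfield L)) p.2) with h𝓜₀
  have hcount : 𝓜₀.Countable := Set.countable_range _
  have hsub : 𝓜₀ ⊆ 𝓜 := by
    rintro _ ⟨p, rfl⟩; exact h𝓜 _ _ _
  have hsep : ∀ k u, u ∉ levelBall L k → ∃ χ ∈ 𝓜₀, (∀ t ∈ levelBall L k, χ t = 1) ∧ χ u ≠ 1 := by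
    intro k u hu
    obtain ⟨i, j, n, h1, h2⟩ := exists_adelicCoordChar_sep ψ hψc hψ k u hu
    exact ⟨_, ⟨((i, j), n), rfl⟩, h1, h2⟩
  exact hasScalarCommutant_schrodingerSystem (μ L) (levelBall L) (isOpen_levelBall L)
    (isCompact_levelBall L) (levelBall_antitone L) (levelBall_nhds L) 𝓜 𝓜₀ hsub hcount hsep

/-! ## §5  PerL L4.2(b) split sentence, adelically: the Levi action on `L²(X)` is forced -/

/-- **Rigidity of the global split Schrödinger model (PerL v5 L4.2(b), tex ll. 610–611, for the
adelic space `X` of tex ll. 259–263 at the split places).**  Let `ω` be ANY unitary representation of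
the model group `U(1)(𝔸_{L⁺}) = Model L` on `L²(X, dx)` normalising the adelic Heisenberg operators
the way the Weil representation does:
`ω(k) τ_y = τ_{k⁻¹•y} ω(k)` for all `y ∈ X`, and `ω(k) M_χ = M_{χ∘(k•·)} ω(k)` for all `χ ∈ 𝓜`, where
`𝓜` is any set of modulation characters containing the adelic coordinate Heisenberg characters for a
family `ψ` of non-trivial continuous additive characters.  Then `ω` IS the RUN-29 representation
`rep L ν`, `(ω(k) f)(x) = ν(k) δ_X(k)^{1/2} f(k⁻¹•x)`, for a UNIQUE unitary character
`ν : Model L →* Circle` — "acting … by `|y|^{3/2} φ(yx)` up to a unitary character", globally. -/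
theorem rep_unique_up_to_character (hψ : ∀ i, ∃ t, ψ i t ≠ 1) (𝓜 : Set C(Space L, Circle))
    (h𝓜 : ∀ (i : SplitIdx L) (j : Fin 3) (s : (basePlaceOf L i.1).adicCompletion (maximalRealSubfield L)),
      adelicCoordChar ψ hψc i j s ∈ 𝓜)
    (ω : Model L →* (Lp ℂ 2 (μ L) ≃ₗᵢ[ℂ] Lp ℂ 2 (μ L)))
    (hτ : ∀ (k : Model L) (y : Space L) (f : Lp ℂ 2 (μ L)),
      ω k (translate (μ L) y f) = translate (μ L) (k⁻¹ • y) (ω k f))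
    (hM : ∀ (k : Model L), ∀ χ ∈ 𝓜, ∀ f : Lp ℂ 2 (μ L),
      ω k (modulate (μ L) χ f) = modulate (μ L) (χ.comp (smulMap k)) (ω k f)) :
    ∃! ν : Model L →* Circle, ω = rep L ν :=
  weilLevi_existsUnique (μ L) 𝓜 (hasScalarCommutant_schrodingerSystem_space ψ hψc hψ 𝓜 h𝓜) ω hτ hM

/-- **Rigidity, consumer form — hypotheses stated inside the coordinate family.**  If a unitary
representation `ω` of `Model L` on `L²(X)` satisfies the two Heisenberg commutation relations of the
Weil representation on the Levi, `ω(k) τ_y = τ_{k⁻¹•y} ω(k)` (`y ∈ X`) and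
`ω(k) M_{v,j,s} = M_{v,j,s·k_v} ω(k)` (all split `v`, `j ∈ Fin 3`, `s ∈ L⁺_v`), then `ω = rep L ν` for a
unique unitary character `ν` of `Model L`. -/
theorem rep_unique_up_to_character_coord (hψ : ∀ i, ∃ t, ψ i t ≠ 1)
    (ω : Model L →* (Lp ℂ 2 (μ L) ≃ₗᵢ[ℂ] Lp ℂ 2 (μ L)))
    (hτ : ∀ (k : Model L) (y : Space L) (f : Lp ℂ 2 (μ L)),
      ω k (translate (μ L) y f) = translate (μ L) (k⁻¹ • y) (ω k f))
    (hM : ∀ (k : Model L) (i : SplitIdx L) (j : Fin 3)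
      (s : (basePlaceOf L i.1).adicCompletion (maximalRealSubfield L)) (f : Lp ℂ 2 (μ L)),
      ω k (modulate (μ L) (adelicCoordChar ψ hψc i j s) f)
        = modulate (μ L) (adelicCoordChar ψ hψc i j (s * ((unitAt k i :
            ((basePlaceOf L i.1).adicCompletion (maximalRealSubfield L))ˣ) :
              (basePlaceOf L i.1).adicCompletion (maximalRealSubfield L)))) (ω k f)) :
    ∃! ν : Model L →* Circle, ω = rep L ν := by
  refine rep_unique_up_to_character ψ hψc hψ (coordCharSet ψ hψc)
    (adelicCoordChar_mem_coordCharSet ψ hψc) ω hτ ?_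
  rintro k χ ⟨i, j, s, rfl⟩ f
  rw [adelicCoordChar_comp_smulMap]
  exact hM k i j s f

/-- The RUN-29 representations `rep L ν` DO normalise the adelic translations this way … -/
theorem rep_translate (ν : Model L →* Circle) (k : Model L) (y : Space L) (f : Lp ℂ 2 (μ L)) :
    rep L ν k (translate (μ L) y f) = translate (μ L) (k⁻¹ • y) (rep L ν k f) :=
  dilationRep_translate (μ L) ν k y f

/-- … and the modulations by EVERY character of `X` (so the hypotheses of
`rep_unique_up_to_character` are satisfied by each `rep L ν`: the rigidity statement is sharp). -/
theorem rep_modulate (ν : Model L →* Circle) (k : Model L) (χ : C(Space L, Circle))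
    (f : Lp ℂ 2 (μ L)) :
    rep L ν k (modulate (μ L) χ f) = modulate (μ L) (χ.comp (smulMap k)) (rep L ν k f) :=
  dilationRep_modulate (μ L) ν k χ f

/-- **Characterisation of the RUN-29 family `(rep L ν)_ν`.**  A unitary representation `ω` of
`Model L = U(1)(𝔸_{L⁺})` on `L²(X)` is one of the `rep L ν` IF AND ONLY IF it normalises the adelic
translations and the modulations by `𝓜` (any set of characters containing the adelic coordinate
Heisenberg characters) the way the Weil representation does. -/
theorem exists_eq_rep_iff (hψ : ∀ i, ∃ t, ψ i t ≠ 1) (𝓜 : Set C(Space L, Circle))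
    (h𝓜 : ∀ (i : SplitIdx L) (j : Fin 3) (s : (basePlaceOf L i.1).adicCompletion (maximalRealSubfield L)),
      adelicCoordChar ψ hψc i j s ∈ 𝓜)
    (ω : Model L →* (Lp ℂ 2 (μ L) ≃ₗᵢ[ℂ] Lp ℂ 2 (μ L))) :
    (∃ ν : Model L →* Circle, ω = rep L ν) ↔
      ((∀ (k : Model L) (y : Space L) (f : Lp ℂ 2 (μ L)),
          ω k (translate (μ L) y f) = translate (μ L) (k⁻¹ • y) (ω k f)) ∧
        ∀ (k : Model L), ∀ χ ∈ 𝓜, ∀ f : Lp ℂ 2 (μ L),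
          ω k (modulate (μ L) χ f) = modulate (μ L) (χ.comp (smulMap k)) (ω k f)) := by
  constructor
  · rintro ⟨ν, rfl⟩
    exact ⟨fun k y f => rep_translate ν k y f, fun k χ _ f => rep_modulate ν k χ f⟩
  · rintro ⟨hτ, hM⟩
    exact (rep_unique_up_to_character ψ hψc hψ 𝓜 h𝓜 ω hτ hM).exists

/-- **The matrix coefficients on indicator vectors are forced** (PerL v5 tex l. 613 / ll. 621–623
"`m(y) = ⟨ω_v(y)φ_v, φ_v⟩ = vol(D ∩ y⁻¹D)·|y|^{3/2}`", adelically and up to the unique character):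
for the ACTUAL `ω` of `rep_unique_up_to_character`,
`⟪1_A, ω(k) 1_A⟫ = ν(k) δ_X(k)^{1/2} vol(A ∩ k⁻¹A)` for every measurable `A ⊆ X` of finite measure. -/
theorem rep_unique_inner_indicator (hψ : ∀ i, ∃ t, ψ i t ≠ 1) (𝓜 : Set C(Space L, Circle))
    (h𝓜 : ∀ (i : SplitIdx L) (j : Fin 3) (s : (basePlaceOf L i.1).adicCompletion (maximalRealSubfield L)),
      adelicCoordChar ψ hψc i j s ∈ 𝓜)
    (ω : Model L →* (Lp ℂ 2 (μ L) ≃ₗᵢ[ℂ] Lp ℂ 2 (μ L)))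
    (hτ : ∀ (k : Model L) (y : Space L) (f : Lp ℂ 2 (μ L)),
      ω k (translate (μ L) y f) = translate (μ L) (k⁻¹ • y) (ω k f))
    (hM : ∀ (k : Model L), ∀ χ ∈ 𝓜, ∀ f : Lp ℂ 2 (μ L),
      ω k (modulate (μ L) χ f) = modulate (μ L) (χ.comp (smulMap k)) (ω k f)) :
    ∃ ν : Model L →* Circle, ∀ (k : Model L) {A : Set (Space L)} (hA : MeasurableSet A)
      (hμA : μ L A ≠ ⊤),
      ⟪indicatorConstLp 2 hA hμA (1 : ℂ), ω k (indicatorConstLp 2 hA hμA (1 : ℂ))⟫_ℂ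
        = weight (Space L) ν k * ((μ L).real (A ∩ (fun x => k • x) ⁻¹' A) : ℂ) :=
  weilLevi_inner_indicator (μ L) 𝓜 (hasScalarCommutant_schrodingerSystem_space ψ hψc hψ 𝓜 h𝓜) ω hτ hM

end Characters

end HodgeCM.PerL34.PureTensor.SchrodingerModel

end
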